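import Summits.PneNP.PneNP.Theses.PermanentDescent
import Literature.Computability.Complexity.CircuitClassesUniformProofs

/-!
# `CollapseMakesPermanentEasy` — negative-side lemmas: the crux and both stubs of line `birth`
# are un-killable short of `P = NP` (standing disprover, crux stmt-PneNP-16142)

Load-bearing analysis of the crux `K = CollapseMakesPermanentEasy : NP ⊆ P → PermBits ∈ P` of route
`PermanentDescent` and of the two stubs of its picked line `birth`
(`CollapseShrinksPermanent` = stmt-PneNP-16144, `UniformizationUnderCollapse` = stmt-PneNP-16145).

* `collapse_iff_not_summit` : the shared hypothesis `NP ⊆ P` is exactly `¬PneNP` (model bridges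
  `P_bool_eq_holds`, `np_bool_eq`).
* `not_summit_of_not_imp` : refuting ANY statement `NP ⊆ P → X` refutes the summit; instances
  `not_summit_of_not_crux`, `not_summit_of_not_collapseShrinksPermanent`,
  `not_summit_of_not_uniformizationUnderCollapse`. Consequently no refutation of this crux or of a stub
  of its line can be landed unless the Clay problem is decided negatively.
* `not_crux_iff`, `not_uniformizationUnderCollapse_iff` : the counter-worlds, unfolded.
* `cruxes_not_both_false` : `¬K → ¬W → False` for the sibling crux `W = PermanentNotInP`.
* `not_cruxWithoutCollapse_iff_permanentNotInP` : dropping the collapse from the crux leaves exactly `¬W`,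
  so the hypothesis is load-bearing precisely if `W` holds (open) — recorded as an `Iff`, no
  `_false_without_` theorem being possible; likewise `not_uniformizationWithoutCollapse_iff` and
  `uniformizationWithoutPPoly_iff_crux` for the two hypotheses of stub `U`.
* `not_crux_of_not_collapseShrinksPermanent`, `not_crux_of_not_uniformizationUnderCollapse` : each stub
  is necessary for the crux (the cut `K ↔ CSP ∧ U` of `Lines/birth.lean` is exact), so a stub-kill is a
  crux-kill is a summit refutation.

All proofs are one-line logic over the route decls; the content is the bookkeeping, machine-checked, that
tells allocation not to spend disprover time on kills inside this route. Companion workfile with the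
barrier-side analysis: `Cruxes/CollapseMakesPermanentEasy/Disproof.lean`.
-/

set_option linter.dupNamespace false

namespace Summit.PneNP.PneNP.Theorems.CollapseMakesPermanentEasy.Negative

open Literature.Computability.Complexity
open Summit.PneNP.PneNP.Theses.PermanentDescent

/-- The bit-graph language of the 0/1 permanent, verbatim the `let PermBits := …` of the route decls.
[folklore] -/
def PermBits : Language Bool :=
  {w | ∃ (n : ℕ) (s : List Bool) (i : ℕ), s.length = n * n ∧ w = Literature.Computability.Complexity.boolPair s (Computability.encodeNat i) ∧ Nat.testBit (Matrix.permanent (Matrix.of fun a b : Fin n => if s.getD ((b : ℕ) + n * (a : ℕ)) false then (1 : ℕ) else 0)) i = true}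

/-- The shared hypothesis `NP ⊆ P` of every item of the route is exactly the negation of the summit.
[folklore] -/
theorem collapse_iff_not_summit : (Nondeterministic.NP ⊆ Classes.P) ↔ ¬ _root_.PneNP := by
  have hP : PNPWave0.P Bool = Classes.P := Literature.Computability.Complexity.P_bool_eq_holds
  have hN : PNPWave0.NP Bool = Nondeterministic.NP := Literature.Computability.Complexity.np_bool_eq
  unfold _root_.PneNP Literature.PNP.PNeNP
  rw [hP, hN]
  simp only [Set.subset_def, not_exists, not_and, not_not]

/-- **Master lemma.** Refuting any implication whose antecedent is the collapse refutes the summit.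
[folklore] -/
theorem not_summit_of_not_imp {X : Prop} (h : ¬ (Nondeterministic.NP ⊆ Classes.P → X)) :
    ¬ _root_.PneNP :=
  fun hs => h fun hc => ((collapse_iff_not_summit.1 hc) hs).elim

/-- A refutation of the crux `CollapseMakesPermanentEasy` decides the Clay problem negatively.
[folklore] -/
theorem not_summit_of_not_crux (h : ¬ CollapseMakesPermanentEasy) : ¬ _root_.PneNP :=
  not_summit_of_not_imp h

/-- Same for stub 1 of line `birth`, the route item `CollapseShrinksPermanent`. [folklore] -/
theorem not_summit_of_not_collapseShrinksPermanent (h : ¬ CollapseShrinksPermanent) : ¬ _root_.PneNP :=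
  not_summit_of_not_imp h

/-- Same for stub 2 of line `birth`, the route item `UniformizationUnderCollapse`. [folklore] -/
theorem not_summit_of_not_uniformizationUnderCollapse (h : ¬ UniformizationUnderCollapse) :
    ¬ _root_.PneNP :=
  not_summit_of_not_imp h

/-- `¬K` unfolded: the counter-world is "Algorithmica without Countica", `NP ⊆ P ∧ PermBits ∉ P`.
[folklore] -/
theorem not_crux_iff :
    ¬ CollapseMakesPermanentEasy ↔ (Nondeterministic.NP ⊆ Classes.P ∧ PermBits ∉ Classes.P) :=
  Classical.not_imp

/-- `¬U` unfolded: a counter-world needs the collapse, small permanent circuits and a hard permanent at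
once. [folklore] -/
theorem not_uniformizationUnderCollapse_iff :
    ¬ UniformizationUnderCollapse ↔
      (Nondeterministic.NP ⊆ Classes.P ∧ PermBits ∈ PPoly ∧ PermBits ∉ Classes.P) := by
  rw [show UniformizationUnderCollapse ↔
      (Nondeterministic.NP ⊆ Classes.P → PermBits ∈ PPoly → PermBits ∈ Classes.P) from Iff.rfl,
    Classical.not_imp, Classical.not_imp]

/-- The route's two cruxes are never both false: a refutation of `K` hands over `PermBits ∉ P`, which
IS the sibling crux `W = PermanentNotInP`. [folklore] -/
theorem cruxes_not_both_false (hK : ¬ CollapseMakesPermanentEasy) (hW : ¬ PermanentNotInP) : False :=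
  hK fun _ => Classical.not_not.1 hW

/-- LOAD-BEARING (crux): `K` with its only hypothesis (the collapse) dropped reads `PermBits ∈ P`, and the
negation of that is LITERALLY the sibling crux `W = PermanentNotInP`. So the hypothesis of `K` is
load-bearing precisely if `W` holds (open): no `_false_without_` theorem can exist short of proving `W`.
[folklore] -/
theorem not_cruxWithoutCollapse_iff_permanentNotInP :
    ¬ (PermBits ∈ Classes.P) ↔ PermanentNotInP :=
  Iff.rfl

/-- LOAD-BEARING (stub `U`): with the collapse dropped, `U` reads "P/poly ⇒ P for the permanent"; its
negation needs polynomial-size permanent circuits together with `W` — un-killable short of exhibiting such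
circuits (in print only `PermBits ∈ P/poly ⇒ P^{#P} = MA` is known, LFKN 1992). [folklore] -/
theorem not_uniformizationWithoutCollapse_iff :
    ¬ (PermBits ∈ PPoly → PermBits ∈ Classes.P) ↔ (PermBits ∈ PPoly ∧ PermanentNotInP) :=
  Classical.not_imp

/-- LOAD-BEARING (stub `U`, the other hypothesis): with `PermBits ∈ P/poly` dropped, `U` is the crux
itself. [folklore] -/
theorem uniformizationWithoutPPoly_iff_crux :
    (Nondeterministic.NP ⊆ Classes.P → PermBits ∈ Classes.P) ↔ CollapseMakesPermanentEasy :=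
  Iff.rfl

/-- Stub `CSP` is necessary for the crux (`K → CSP` by the tree theorem `P ⊆ P/poly`), so killing it
kills `K` and thereby refutes the summit. [folklore] -/
theorem not_crux_of_not_collapseShrinksPermanent (h : ¬ CollapseShrinksPermanent) :
    ¬ CollapseMakesPermanentEasy :=
  fun hK => h fun hc => P_subset_PPoly_holds (hK hc)

/-- Stub `U` is necessary for the crux (it is `K` under an extra hypothesis). [folklore] -/
theorem not_crux_of_not_uniformizationUnderCollapse (h : ¬ UniformizationUnderCollapse) :
    ¬ CollapseMakesPermanentEasy :=
  fun hK => h fun hc _ => hK hc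

end Summit.PneNP.PneNP.Theorems.CollapseMakesPermanentEasy.Negative
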